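import Mathlib.Analysis.SpecialFunctions.JapaneseBracket
import Summits.AtomisticToContinuum.Crystallization.Theorems.FreeSplittingCertificatesStrictSplittingRuleFarPencilIntegrable
import Summits.AtomisticToContinuum.Crystallization.Theorems.FreeSplittingCertificatesStrictSplittingRuleFarPencilCutoff

/-!
# `StrictSplittingRule` (stmt-AtomisticToContinuum-12560): `|x|⁻⁴` decay ⇒ integrability — the tool for the affine-tailed far field

Route `FreeSplittingCertificates`, crux r3 `StrictSplittingRule` (H12⋆ = `stub_coreJointCoercive`), unit b2b-freesplit-B gen 10.
VALUE = the integrability tool that `farPencil_integral_le_of_integrable` (`…FarPencilIntegrable`) needs for non-compactly-supported far fields — NOT a proof of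
H12⋆, NOT summit progress.

The far field of the H12⋆ architecture is affine outside the support of the lattice displacement, so its densities are not compactly supported but decay like
`|x|⁻⁵ … |x|⁻⁶` (HOME CERT.md §18 (7)).  `integrable_of_continuous_of_decay`: a continuous real function on `ℝ³ = Fin 3 → ℝ` with `|f x| ≤ C·(fpSq x)⁻²`
(`= C|x|⁻⁴`, Euclidean) outside a sup-norm ball is integrable (majorant `K·(1+‖x‖²)⁻²`, Mathlib `integrable_rpow_neg_one_add_norm_sq` with `finrank = 3 < 4`);
with the norm comparisons `norm_sq_le_fpSq : ‖x‖² ≤ fpSq x` and `fpSq_le_three_mul_norm_sq : fpSq x ≤ 3‖x‖²` between the sup norm of `Fin 3 → ℝ` and the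
Euclidean square `fpSq`.  HONEST FRAMING: a measure-theory helper; the decay estimates of the actual affine-tail densities are still to be written;
NOT a proof of H12⋆, NOT summit progress.
-/

noncomputable section

open MeasureTheory Topology Filter

namespace Summit.AtomisticToContinuum.Crystallization.Theorems.StrictSplittingRuleBirth

/-- Sup norm versus Euclidean square: `‖x‖² ≤ fpSq x`. -/
theorem norm_sq_le_fpSq (x : Fin 3 → ℝ) : ‖x‖ ^ 2 ≤ fpSq x := by
  have hle : ∀ i : Fin 3, x i ^ 2 ≤ fpSq x := by
    intro i
    fin_cases i <;> simp [fpSq] <;> nlinarith [sq_nonneg (x 0), sq_nonneg (x 1), sq_nonneg (x 2)]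
  have h : ‖x‖ ≤ Real.sqrt (fpSq x) := by
    refine (pi_norm_le_iff_of_nonneg (Real.sqrt_nonneg _)).2 fun i => ?_
    rw [Real.norm_eq_abs, ← Real.sqrt_sq_eq_abs]
    exact Real.sqrt_le_sqrt (hle i)
  have h2 : ‖x‖ ^ 2 ≤ Real.sqrt (fpSq x) ^ 2 := pow_le_pow_left₀ (norm_nonneg _) h 2
  rwa [Real.sq_sqrt (fpSq_nonneg x)] at h2

/-- Euclidean square versus sup norm: `fpSq x ≤ 3‖x‖²`. -/
theorem fpSq_le_three_mul_norm_sq (x : Fin 3 → ℝ) : fpSq x ≤ 3 * ‖x‖ ^ 2 := by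
  have h : ∀ i : Fin 3, x i ^ 2 ≤ ‖x‖ ^ 2 := by
    intro i
    have h1 : |x i| ≤ ‖x‖ := by simpa [Real.norm_eq_abs] using norm_le_pi_norm x i
    have h2 : |x i| ^ 2 ≤ ‖x‖ ^ 2 := pow_le_pow_left₀ (abs_nonneg _) h1 2
    simpa [sq_abs] using h2
  have h0 := h 0; have h1 := h 1; have h2 := h 2
  unfold fpSq
  linarith

/-- **Decay ⇒ integrability on `ℝ³`**: a continuous `f` with `|f x| ≤ C·(fpSq x)⁻²` (`= C|x|⁻⁴`) for `‖x‖ ≥ R` (`R ≥ 1`, sup norm) is integrable. -/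
theorem integrable_of_continuous_of_decay {f : (Fin 3 → ℝ) → ℝ} (hf : Continuous f) {R C : ℝ} (hR : 1 ≤ R)
    (hdec : ∀ x, R ≤ ‖x‖ → |f x| ≤ C * ((fpSq x)⁻¹) ^ 2) : Integrable f := by
  have hKc : IsCompact (Metric.closedBall (0 : Fin 3 → ℝ) R) := isCompact_closedBall _ _
  obtain ⟨B, hB⟩ := hKc.exists_bound_of_continuousOn (f := f) hf.continuousOn
  set K : ℝ := max (4 * |C|) (|B| * (1 + R ^ 2) ^ 2) with hK
  have hK1 : 4 * |C| ≤ K := le_max_left _ _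
  have hK2 : |B| * (1 + R ^ 2) ^ 2 ≤ K := le_max_right _ _
  have hK0 : 0 ≤ K := le_trans (by positivity) hK1
  have hrank : (Module.finrank ℝ (Fin 3 → ℝ) : ℝ) < 4 := by
    rw [Module.finrank_fin_fun]; norm_num
  have hmaj : Integrable fun x : Fin 3 → ℝ => K * (((1 : ℝ) + ‖x‖ ^ 2) ^ (-(4 : ℝ) / 2)) :=
    (integrable_rpow_neg_one_add_norm_sq hrank).const_mul K
  refine hmaj.mono' hf.aestronglyMeasurable (Filter.Eventually.of_forall fun x => ?_)
  have hq : 0 < (1 : ℝ) + ‖x‖ ^ 2 := by positivity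
  have hpow : ((1 : ℝ) + ‖x‖ ^ 2) ^ (-(4 : ℝ) / 2) = ((1 + ‖x‖ ^ 2) ^ 2)⁻¹ := by
    rw [show (-(4 : ℝ) / 2) = -(2 : ℝ) by norm_num, Real.rpow_neg hq.le, Real.rpow_two]
  rw [hpow, Real.norm_eq_abs]
  by_cases hx : R ≤ ‖x‖
  · -- decay region: |f| ≤ C s⁻² ≤ |C| (‖x‖²)⁻² ≤ 4|C| ((1+‖x‖²)²)⁻¹ ≤ K ((1+‖x‖²)²)⁻¹
    have hx1 : 1 ≤ ‖x‖ := hR.trans hx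
    have hn2 : 1 ≤ ‖x‖ ^ 2 := by nlinarith
    have hs : ‖x‖ ^ 2 ≤ fpSq x := norm_sq_le_fpSq x
    have hs0 : 0 < fpSq x := lt_of_lt_of_le (by positivity) hs
    have hinv : (fpSq x)⁻¹ ≤ (‖x‖ ^ 2)⁻¹ := inv_anti₀ (by positivity) hs
    have hinv0 : 0 ≤ (fpSq x)⁻¹ := inv_nonneg.2 hs0.le
    have h1 : ((fpSq x)⁻¹) ^ 2 ≤ ((‖x‖ ^ 2)⁻¹) ^ 2 := pow_le_pow_left₀ hinv0 hinv 2
    have h2 : ((‖x‖ ^ 2)⁻¹) ^ 2 ≤ 4 * ((1 + ‖x‖ ^ 2) ^ 2)⁻¹ := by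
      have hn : (1 + ‖x‖ ^ 2) ^ 2 ≤ 4 * (‖x‖ ^ 2) ^ 2 := by nlinarith
      have hpos : 0 < (‖x‖ ^ 2) ^ 2 := by positivity
      have hpos2 : 0 < (1 + ‖x‖ ^ 2) ^ 2 := by positivity
      rw [inv_pow, ← one_div, ← div_eq_mul_inv, div_le_div_iff₀ hpos hpos2]
      linarith
    have h3 : |f x| ≤ |C| * ((fpSq x)⁻¹) ^ 2 :=
      (hdec x hx).trans (mul_le_mul_of_nonneg_right (le_abs_self C) (by positivity))
    calc |f x| ≤ |C| * ((fpSq x)⁻¹) ^ 2 := h3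
      _ ≤ |C| * (4 * ((1 + ‖x‖ ^ 2) ^ 2)⁻¹) := mul_le_mul_of_nonneg_left (h1.trans h2) (abs_nonneg C)
      _ = (4 * |C|) * ((1 + ‖x‖ ^ 2) ^ 2)⁻¹ := by ring
      _ ≤ K * ((1 + ‖x‖ ^ 2) ^ 2)⁻¹ := mul_le_mul_of_nonneg_right hK1 (by positivity)
  · -- ball: |f| ≤ B ≤ |B| ≤ |B|(1+R²)²·((1+‖x‖²)²)⁻¹ ≤ K·((1+‖x‖²)²)⁻¹
    have hxR : ‖x‖ ≤ R := le_of_lt (not_le.1 hx)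
    have hmem : x ∈ Metric.closedBall (0 : Fin 3 → ℝ) R := by simpa using hxR
    have hfB : |f x| ≤ |B| := by
      have := hB x hmem
      rw [Real.norm_eq_abs] at this
      exact this.trans (le_abs_self B)
    have hcmp : (1 + ‖x‖ ^ 2) ^ 2 ≤ (1 + R ^ 2) ^ 2 := by
      have : ‖x‖ ^ 2 ≤ R ^ 2 := pow_le_pow_left₀ (norm_nonneg _) hxR 2
      nlinarith [sq_nonneg ‖x‖]
    have hq2 : 0 < (1 + ‖x‖ ^ 2) ^ 2 := by positivity
    have h4 : 1 ≤ (1 + R ^ 2) ^ 2 * ((1 + ‖x‖ ^ 2) ^ 2)⁻¹ := by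
      rw [← div_eq_mul_inv, le_div_iff₀ hq2, one_mul]
      exact hcmp
    calc |f x| ≤ |B| * 1 := by rw [mul_one]; exact hfB
      _ ≤ |B| * ((1 + R ^ 2) ^ 2 * ((1 + ‖x‖ ^ 2) ^ 2)⁻¹) := mul_le_mul_of_nonneg_left h4 (abs_nonneg B)
      _ = (|B| * (1 + R ^ 2) ^ 2) * ((1 + ‖x‖ ^ 2) ^ 2)⁻¹ := by ring
      _ ≤ K * ((1 + ‖x‖ ^ 2) ^ 2)⁻¹ := mul_le_mul_of_nonneg_right hK2 (by positivity)

/-! ## First application: the receipts density of a field with constant gradient outside a ball -/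

/-- **Receipts density of an affine-tailed field is integrable**: if `v ∈ C²` vanishes near `0` and has CONSTANT gradient matrix `G₀` outside the sup-norm
ball of radius `R ≥ 1` (e.g. `v` affine there), then `x ↦ fpDen x (∇v x)` is integrable — one of the four hypotheses of `farPencil_integral_le_of_integrable`. -/
theorem integrable_fpDen_of_constGrad {v : (Fin 3 → ℝ) → (Fin 3 → ℝ)} (hv : ContDiff ℝ 2 v) (h0 : v =ᶠ[𝓝 0] 0)
    {R : ℝ} (hR : 1 ≤ R) (G₀ : Fin 3 → Fin 3 → ℝ) (htail : ∀ x, R ≤ ‖x‖ → fpGrad v x = G₀) :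
    Integrable fun x => fpDen x (fpGrad v x) := by
  -- continuity: at `x ≠ 0` from `continuousAt_fpDen`, at `0` the density vanishes near `0`
  have hcont : Continuous fun x => fpDen x (fpGrad v x) := by
    refine continuous_iff_continuousAt.2 fun y => ?_
    by_cases hy : y = 0
    · subst hy
      have hev : (fun x => fpDen x (fpGrad v x)) =ᶠ[𝓝 0] fun _ => (0 : ℝ) := by
        filter_upwards [(fp_fderiv_eventuallyEq_zero h0)] with z hz
        have : fpGrad v z = fun _ _ => 0 := by funext i j; simp [fpGrad, hz]
        simp [fpDen, fpRec, fpTr, fpSymSq, this]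
      exact hev.continuousAt
    · exact continuousAt_fpDen hv hy
  refine integrable_of_continuous_of_decay hcont hR (C := fpRec G₀) fun x hx => ?_
  have hs : 1 ≤ fpSq x := le_trans (by nlinarith [hR.trans hx, norm_nonneg x]) (norm_sq_le_fpSq x)
  have hu0 : 0 ≤ (fpSq x)⁻¹ := inv_nonneg.2 (by linarith)
  have hu1 : (fpSq x)⁻¹ ≤ 1 := inv_le_one_of_one_le₀ hs
  rw [htail x hx, abs_of_nonneg (by unfold fpDen; exact mul_nonneg (pow_nonneg hu0 3) (fpRec_nonneg G₀))]
  unfold fpDen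
  have : (fpSq x)⁻¹ ^ 3 ≤ (fpSq x)⁻¹ ^ 2 := by
    rw [pow_succ]
    exact mul_le_of_le_one_right (pow_nonneg hu0 2) hu1
  nlinarith [fpRec_nonneg G₀, this]

end Summit.AtomisticToContinuum.Crystallization.Theorems.StrictSplittingRuleBirth
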